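import Mathlib
import Summits.NavierStokesRegularity.NavierStokesRegularity.Theorems.EulerZoomLiouvillePowerGaugeEulerLiouvilleSelfSimilarBernoulliFeeding
import Summits.NavierStokesRegularity.NavierStokesRegularity.Theorems.EulerZoomLiouvillePowerGaugeEulerLiouvilleSelfSimilarBernoulliLandscape
import Summits.NavierStokesRegularity.NavierStokesRegularity.Theorems.EulerZoomLiouvillePowerGaugeEulerLiouvilleSelfSimilarBackwardEscape
import Summits.NavierStokesRegularity.NavierStokesRegularity.Theorems.EulerZoomLiouvillePowerGaugeEulerLiouvilleSelfSimilarBernoulliSqueeze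
import Summits.NavierStokesRegularity.NavierStokesRegularity.Theorems.EulerZoomLiouvillePowerGaugeEulerLiouvilleSelfSimilarVorticityTransport
import HarnessLib

/-!
# «FAST VORTICAL CHANNELS SQUEEZE VOLUME TOO FAST» — GROWTH ONLY WHERE IT MATTERS (crux `EulerZoomLiouville.PowerGaugeEulerLiouville` =
# stmt-NavierStokesRegularity-19832, THE ONE STATEMENT; LEAD ns-typeII-p2 g12 RESIDUE-MEMO-g12 T3, width seat ns-ezl-w1 g3)
Variant of ns-ezl-w5 g0's `Loc.curl_eq_zero_of_vorticalFastChannel_of_thin` (`…SelfSimilarBernoulliSqueezeVortical`, p635086): the GLOBAL linear growth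
`‖U y‖ ≤ K₁(1+‖y‖)` is replaced by growth on the far VORTICAL HIGH sets, level by level — `∀ h, ∃ K₁ R₁, ∀ y, R₁ ≤ ‖y‖ → h < ℋ(y) → curl U y ≠ 0 →
‖U y‖ ≤ K₁(1+‖y‖)`.  The growth only serves as the UPPER escape rate `‖Y(s)‖ ≤ ‖y‖e^{C₁ s}` (`C₁ = 2K₁`) of backward orbits from the blob
`A ⊂ {ℋ > h} ∩ {curl U ≠ 0}`, which fixes the radius `Rbig` of the cut-off field; such orbits stay Bernoulli-high (ℋ non-decreasing backward) and vortical
(linear ODE for the weighted vorticity) while inside `B_{Rbig}`, so the local growth re-closes the upper bound: the continuity induction on `[0,T]` carries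
BOTH bounds `‖y‖ ≤ ‖Y s‖ ≤ ‖y‖e^{C₁s}`, and at the first bad time both persist by openness (strict channel at rate `c₁/2`; `‖Y t₀‖ > max(R₁,1)`, `ℋ > h`,
`curl U ≠ 0` open along the orbit).
* **`Loc.curl_eq_zero_of_vorticalFastChannel_of_thin_of_highGrowth`** — `C²` CIV profile, `0 < γ < ½`, growth on the far vortical high sets, thin high
  sets with rate `m`, vortical far fast channel of rate `c₁`, `c₁ m > 3γ` ⇒ `curl U ≡ 0`.
HONEST LABEL: partial model-class stratum (weaker hypothesis than p635086).  WHAT THIS IS NOT: not NS, not E — a tool for THE ONE STATEMENT,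
`--supports` stmt-19832; 19832 OPEN. [folklore; ConstantinIgnatovaVicol2026Putative §3.4.1 (3.21)–(3.24), §3.4.3 (3.30)–(3.33)]
-/
noncomputable section

-- flat `Theorems/<Route><Decl>…` files of one crux share the namespace of the crux (tree convention)
set_option linter.dupNamespace false

open MeasureTheory Set Filter Topology Metric Function InnerProductSpace
open scoped RealInnerProductSpace NNReal ENNReal ContDiff

namespace Summit.NavierStokesRegularity.NavierStokesRegularity.Theorems.PowerGaugeEulerLiouville.Loc

open Literature.Analysis Literature.Analysis.FluidPDE
open Summit.NavierStokesRegularity.NavierStokesRegularity.Theorems.PowerGaugeEulerLiouville.BernoulliLandscape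
open Summit.NavierStokesRegularity.NavierStokesRegularity.Theorems.PowerGaugeEulerLiouville.BackwardEscape
open Summit.NavierStokesRegularity.NavierStokesRegularity.Theorems.PowerGaugeEulerLiouville.NodalFiniteness

variable {γ : ℝ} {U : EuclideanSpace ℝ (Fin 3) → EuclideanSpace ℝ (Fin 3)} {P : EuclideanSpace ℝ (Fin 3) → ℝ}

/-! ### The squeeze -/

set_option maxHeartbeats 1600000 in
-- adapted from ns-ezl-w5 g0's `Loc.curl_eq_zero_of_vorticalFastChannel_of_thin` (…SelfSimilarBernoulliSqueezeVortical, p635086)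
/-- **FAST VORTICAL CHANNELS SQUEEZE VOLUME TOO FAST — growth only on the far vortical high sets.**  As
`Loc.curl_eq_zero_of_vorticalFastChannel_of_thin`, but the linear growth `‖U y‖ ≤ K₁(1+‖y‖)` is asked, for every level `h`, only at far points of
`{ℋ > h}` with `curl U y ≠ 0` (constants depending on the level); backward orbits of far vortical high points stay vortical and high, so the growth
bound along them — the only place it is used — survives. [folklore; ConstantinIgnatovaVicol2026Putative §3.4] -/
theorem curl_eq_zero_of_vorticalFastChannel_of_thin_of_highGrowth (hprof : IsSelfSimilarEulerProfile γ 0 U P) (hγ : 0 < γ)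
    (hγ2 : γ < 1 / 2)
    (hgrow : ∀ h : ℝ, ∃ K₁ R₁ : ℝ, ∀ y : EuclideanSpace ℝ (Fin 3), R₁ ≤ ‖y‖ → h < selfSimilarBernoulli γ 0 U P y →
      curl U y ≠ 0 → ‖U y‖ ≤ K₁ * (1 + ‖y‖))
    {m c₁ : ℝ} (hc₁ : 0 < c₁) (hrace : 3 * γ < c₁ * m)
    (hthin : ∀ h : ℝ, ∃ C R₂ : ℝ, 0 < R₂ ∧ ∀ R : ℝ, R₂ ≤ R →
      volume ({y : EuclideanSpace ℝ (Fin 3) | h < selfSimilarBernoulli γ 0 U P y} ∩ {y | R ≤ ‖y‖}) ≤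
        ENNReal.ofReal (C * R ^ (-m)))
    (hfast : ∀ h : ℝ, ∃ R₀ : ℝ, ∀ y : EuclideanSpace ℝ (Fin 3), R₀ ≤ ‖y‖ → h < selfSimilarBernoulli γ 0 U P y →
      curl U y ≠ 0 → ⟪y, selfSimilarTransport γ 0 U y⟫ ≤ -(c₁ * ‖y‖ ^ 2))
    (x₀ : EuclideanSpace ℝ (Fin 3)) : curl U x₀ = 0 := by
  by_contra hx₀
  set Hb : EuclideanSpace ℝ (Fin 3) → ℝ := selfSimilarBernoulli γ 0 U P with hHb
  have hHc : Continuous Hb := hprof.contDiff_selfSimilarBernoulli.continuous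
  have hγ2' : γ ≤ 1 / 2 := hγ2.le
  set h : ℝ := Hb x₀ - 1 with hh
  obtain ⟨C, R₂, hR₂, hthinR⟩ := hthin h
  obtain ⟨R₀, hfastR⟩ := hfast h
  obtain ⟨K₁', R₁, hgrowR⟩ := hgrow h
  set K₁ : ℝ := max K₁' 0 with hK₁def
  have hK₁0 : 0 ≤ K₁ := le_max_right _ _
  have hK₁ : ∀ y : EuclideanSpace ℝ (Fin 3), R₁ ≤ ‖y‖ → h < Hb y → curl U y ≠ 0 → ‖U y‖ ≤ K₁ * (1 + ‖y‖) :=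
    fun y h1 h2 h3 => (hgrowR y h1 h2 h3).trans (mul_le_mul_of_nonneg_right (le_max_left _ _) (by positivity))
  set C' : ℝ := max C 0 with hC'
  have hC'0 : 0 ≤ C' := le_max_right _ _
  have hthinR' : ∀ R : ℝ, R₂ ≤ R → volume ({y : EuclideanSpace ℝ (Fin 3) | h < Hb y} ∩ {y | R ≤ ‖y‖}) ≤ ENNReal.ofReal (C' * R ^ (-m)) :=
    fun R hR => (hthinR R hR).trans (ENNReal.ofReal_le_ofReal (mul_le_mul_of_nonneg_right (le_max_left _ _) (Real.rpow_nonneg (hR₂.le.trans hR) _)))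
  set R : ℝ := max (max R₀ (max R₁ R₂)) (max ‖x₀‖ 1) + 1 with hRdef
  have hRR₀ : R₀ ≤ R - 1 := by
    rw [hRdef]; linarith [le_max_left R₀ (max R₁ R₂), le_max_left (max R₀ (max R₁ R₂)) (max ‖x₀‖ 1)]
  have hRR₁ : R₁ ≤ R - 1 := by
    rw [hRdef]; linarith [le_max_left R₁ R₂, le_max_right R₀ (max R₁ R₂), le_max_left (max R₀ (max R₁ R₂)) (max ‖x₀‖ 1)]
  have hRR₂ : R₂ ≤ R - 1 := by
    rw [hRdef]; linarith [le_max_right R₁ R₂, le_max_right R₀ (max R₁ R₂), le_max_left (max R₀ (max R₁ R₂)) (max ‖x₀‖ 1)]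
  have hR1 : 1 ≤ R - 1 := by rw [hRdef]; linarith [le_max_right ‖x₀‖ 1, le_max_right (max R₀ (max R₁ R₂)) (max ‖x₀‖ 1)]
  have hRx₀ : ‖x₀‖ < R := by rw [hRdef]; linarith [le_max_left ‖x₀‖ 1, le_max_right (max R₀ (max R₁ R₂)) (max ‖x₀‖ 1)]
  have hR0 : 0 < R - 1 := by linarith
  have hhx₀ : h < Hb x₀ := by rw [hh]; linarith
  obtain ⟨y₀, hy₀R, -, hy₀curl, hy₀h⟩ := exists_fastInflow_vortical_bernoulli_gt hprof hγ hγ2 hx₀ hhx₀ hRx₀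
  have hcurlc : Continuous (curl U) := (differentiable_curl_of_contDiff hprof.contDiff_velocity).continuous
  have hO : IsOpen ({y : EuclideanSpace ℝ (Fin 3) | h < Hb y} ∩ {y | curl U y ≠ 0}) :=
    (isOpen_lt continuous_const hHc).inter (isOpen_ne_fun hcurlc continuous_const)
  obtain ⟨ε, hε, hεsub⟩ := Metric.isOpen_iff.1 hO y₀ ⟨hy₀h, hy₀curl⟩
  set r : ℝ := min ε 1 / 2 with hr
  have hr0 : 0 < r := by rw [hr]; positivity
  have hrε : r < ε := by rw [hr]; linarith [min_le_left ε 1]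
  have hr1 : r < 1 := by rw [hr]; linarith [min_le_right ε 1]
  set A : Set (EuclideanSpace ℝ (Fin 3)) := ball y₀ r with hA
  have hAm : MeasurableSet A := measurableSet_ball
  have hAh : ∀ y ∈ A, h < Hb y := fun y hy => (hεsub (ball_subset_ball hrε.le hy)).1
  have hAcurl : ∀ y ∈ A, curl U y ≠ 0 := fun y hy => (hεsub (ball_subset_ball hrε.le hy)).2
  have hAR : ∀ y ∈ A, R - 1 < ‖y‖ := fun y hy => by
    have h1 : ‖y₀‖ - ‖y‖ ≤ ‖y₀ - y‖ := norm_sub_norm_le y₀ y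
    rw [hA, mem_ball] at hy; rw [← dist_eq_norm, dist_comm] at h1; linarith
  have hApos : 0 < volume A := measure_ball_pos volume y₀ hr0; have hAtop : volume A < ⊤ := measure_ball_lt_top
  have hsqueeze : ∀ T : ℝ, 0 ≤ T →
      volume A ≤ ENNReal.ofReal (C' * (R - 1) ^ (-m) * Real.exp ((3 * γ - c₁ * m) * T)) := by
    intro T hT
    set C₁ : ℝ := 2 * K₁ with hC₁
    set Rbig : ℝ := (R + 1) * Real.exp (C₁ * T) + 2 with hRbig
    have hRbig0 : 0 < Rbig := by rw [hRbig]; positivity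
    obtain ⟨V, hV2, ⟨M, hM⟩, hsmul, ⟨K, hK⟩, hVU⟩ := exists_cutoff_local_smul hprof.contDiff_velocity hRbig0
    have hV1 : ContDiff ℝ 1 V := hV2.of_le (by norm_num)
    have hVlin : ∀ y, R₁ ≤ ‖y‖ → h < Hb y → curl U y ≠ 0 → ‖V y‖ ≤ K₁ * (1 + ‖y‖) := by
      intro y h1 h2 h3
      obtain ⟨c, hc0, hc1, hcy⟩ := hsmul y
      rw [hcy, norm_smul, Real.norm_of_nonneg hc0]
      exact (mul_le_of_le_one_left (norm_nonneg _) hc1).trans (hK₁ y h1 h2 h3)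
    set Φ : ℝ → EuclideanSpace ℝ (Fin 3) → EuclideanSpace ℝ (Fin 3) :=
      ODE.evolutionMap (fun _ : ℝ => selfSimilarTransport γ 0 V) 0 with hΦ
    have hflow_add : ∀ (s t : ℝ) (y : EuclideanSpace ℝ (Fin 3)), Φ (s + t) y = Φ s (Φ t y) :=
      fun s t y => C2.Kelvin.flow_add (γ := γ) hV1 hK s t y
    have hY : ∀ y t, HasDerivAt (fun r => Φ (-r) y) ((-1 : ℝ) • selfSimilarTransport γ 0 V (Φ (-t) y)) t :=
      fun y t => C2.Kelvin.hasDerivAt_flow_neg (γ := γ) hV1 hK y t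
    have hWU : ∀ z : EuclideanSpace ℝ (Fin 3), ‖z‖ < Rbig → selfSimilarTransport γ 0 V z = selfSimilarTransport γ 0 U z := by
      intro z hz
      simp only [selfSimilarTransport_apply, hVU z (mem_ball_zero_iff.2 hz)]
    have hslow : ∀ z : EuclideanSpace ℝ (Fin 3), 1 ≤ ‖z‖ → R₁ ≤ ‖z‖ → h < Hb z → curl U z ≠ 0 →
        -(C₁ * ‖z‖ ^ 2) ≤ ⟪z, selfSimilarTransport γ 0 V z⟫ := by
      intro z hz hz1 hz2 hz3
      rw [selfSimilarTransport_apply, sub_zero, inner_add_right, real_inner_smul_right, real_inner_self_eq_norm_sq]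
      have h1 : |⟪z, V z⟫| ≤ ‖z‖ * ‖V z‖ := abs_real_inner_le_norm _ _
      have h2 : ‖z‖ * ‖V z‖ ≤ ‖z‖ * (K₁ * (1 + ‖z‖)) := mul_le_mul_of_nonneg_left (hVlin z hz1 hz2 hz3) (norm_nonneg _)
      have h3 : -⟪z, V z⟫ ≤ ‖z‖ * (K₁ * (1 + ‖z‖)) := (neg_le_abs _).trans (h1.trans h2)
      have h4 : ‖z‖ * (K₁ * (1 + ‖z‖)) ≤ 2 * K₁ * ‖z‖ ^ 2 := by
        have h41 : K₁ * ‖z‖ * 1 ≤ K₁ * ‖z‖ * ‖z‖ :=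
          mul_le_mul_of_nonneg_left hz (mul_nonneg hK₁0 (norm_nonneg z))
        nlinarith [h41]
      have h5 : 0 ≤ γ * ‖z‖ ^ 2 := by positivity
      rw [hC₁]
      linarith
    have horbit : ∀ y ∈ A, ∀ t ∈ Icc 0 T,
        ‖y‖ * Real.exp (c₁ * t) ≤ ‖Φ (-t) y‖ ∧ ‖Φ (-t) y‖ ≤ ‖y‖ * Real.exp (C₁ * t) ∧ h < Hb (Φ (-t) y) := by
      intro y hy
      have hy1 : 1 ≤ ‖y‖ := hR1.trans (hAR y hy).le
      have hyR₀ : R₀ ≤ ‖y‖ := hRR₀.trans (hAR y hy).le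
      have hyR₁ : R₁ ≤ ‖y‖ := hRR₁.trans (hAR y hy).le
      have hyR1 : ‖y‖ ≤ R + 1 := by
        rw [hA, mem_ball] at hy
        have h1 : ‖y‖ - ‖y₀‖ ≤ ‖y - y₀‖ := norm_sub_norm_le y y₀
        rw [← dist_eq_norm] at h1
        linarith
      set Y : ℝ → EuclideanSpace ℝ (Fin 3) := fun t => Φ (-t) y with hYdef
      have hY0 : Y 0 = y := by simp [hYdef, hΦ, ODE.evolutionMap_self]
      have hYc : Continuous Y := continuous_iff_continuousAt.2 fun t => (hY y t).continuousAt
      have hC₁0 : 0 ≤ C₁ := by rw [hC₁]; positivity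
      have hgood : ∀ t, 0 ≤ t → t ≤ T → (∀ s ∈ Icc 0 t, ‖y‖ ≤ ‖Y s‖ ∧ ‖Y s‖ ≤ ‖y‖ * Real.exp (C₁ * s)) →
          ∀ s ∈ Icc 0 t, ‖y‖ * Real.exp (c₁ * s) ≤ ‖Y s‖ ∧ ‖Y s‖ ≤ ‖y‖ * Real.exp (C₁ * s) ∧ h < Hb (Y s) ∧
            ⟪Y s, selfSimilarTransport γ 0 V (Y s)⟫ ≤ -(c₁ * ‖Y s‖ ^ 2) ∧ curl U (Y s) ≠ 0 ∧ ‖Y s‖ < Rbig - 1 := by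
        intro t ht0 htT hg
        have hup : ∀ s ∈ Icc 0 t, ‖Y s‖ ≤ ‖y‖ * Real.exp (C₁ * s) := fun s hs => (hg s hs).2
        have hin : ∀ s ∈ Icc 0 t, ‖Y s‖ < Rbig - 1 := by
          intro s hs
          have h1 : Real.exp (C₁ * s) ≤ Real.exp (C₁ * T) := Real.exp_le_exp.2 (mul_le_mul_of_nonneg_left (hs.2.trans htT) hC₁0)
          have h2 : ‖y‖ * Real.exp (C₁ * s) ≤ (R + 1) * Real.exp (C₁ * T) := mul_le_mul hyR1 h1 (Real.exp_pos _).le (by linarith)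
          rw [hRbig]; linarith [hup s hs]
        have hYU : ∀ s ∈ Icc 0 t, HasDerivAt Y ((-1 : ℝ) • selfSimilarTransport γ 0 U (Y s)) s := by
          intro s hs
          have h1 := hY y s
          rwa [hWU _ (by linarith [hin s hs])] at h1
        have hH : ∀ s ∈ Icc 0 t, h < Hb (Y s) := by
          intro s hs
          have h1 := selfSimilarBernoulli_monotone_backward hprof hγ2' hs.1 (fun σ hσ => hYU σ ⟨hσ.1, hσ.2.trans hs.2⟩)
          rw [hY0] at h1
          exact lt_of_lt_of_le (hAh y hy) h1
        have hvort : ∀ s ∈ Icc 0 t, curl U (Y s) ≠ 0 := by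
          intro s₁ hs₁ hzero
          set Acl : ℝ → EuclideanSpace ℝ (Fin 3) →L[ℝ] EuclideanSpace ℝ (Fin 3) :=
            fun σ => (-1 : ℝ) • fderiv ℝ (selfSimilarTransport γ 0 U) (Y σ) with hAcl
          set w : ℝ → EuclideanSpace ℝ (Fin 3) := fun σ => Real.exp ((-1 : ℝ) * (1 + γ) * σ) • curl U (Y σ) with hw
          have hw' : ∀ σ ∈ Icc 0 s₁, HasDerivAt w (Acl σ (w σ)) σ := fun σ hσ =>
            hasDerivAt_weightedCurl_comp hprof (hYU σ ⟨hσ.1, hσ.2.trans hs₁.2⟩)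
          have hAc : Continuous fun σ => Acl σ := by
            exact ((continuous_fderiv_transport hprof).comp hYc).const_smul (-1 : ℝ)
          obtain ⟨Kb, hKb⟩ := (isCompact_Icc (a := (0 : ℝ)) (b := s₁)).exists_bound_of_continuousOn hAc.continuousOn
          have hKV : ∀ σ ∈ Icc 0 s₁, LipschitzOnWith (Real.toNNReal Kb) (fun z : EuclideanSpace ℝ (Fin 3) => Acl σ z) univ := by
            intro σ hσ
            refine ((Acl σ).lipschitz.weaken ?_).lipschitzOnWith
            rw [← NNReal.coe_le_coe, coe_nnnorm, Real.coe_toNNReal _ ((norm_nonneg _).trans (hKb σ hσ))]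
            exact hKb σ hσ
          have hwc : ContinuousOn w (Icc 0 s₁) := fun σ hσ => (hw' σ hσ).continuousAt.continuousWithinAt
          have hws₁ : w s₁ = 0 := by simp [hw, hzero]
          have hEq : EqOn w (fun _ => (0 : EuclideanSpace ℝ (Fin 3))) (Icc 0 s₁) :=
            ODE_solution_unique_of_mem_Icc_left (v := fun σ z => Acl σ z) (s := fun _ => univ)
              (fun σ hσ => hKV σ (Ioc_subset_Icc_self hσ)) hwc
              (fun σ hσ => (hw' σ (Ioc_subset_Icc_self hσ)).hasDerivWithinAt) (fun _ _ => mem_univ _)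
              continuousOn_const
              (fun σ _ => by simpa using (hasDerivWithinAt_const σ (Iic σ) (0 : EuclideanSpace ℝ (Fin 3))))
              (fun _ _ => mem_univ _) (by simpa using hws₁)
          have hw0 : w 0 = 0 := hEq ⟨le_rfl, hs₁.1⟩
          have : curl U y = 0 := by simpa [hw, hY0] using hw0
          exact hAcurl y hy this
        have hch : ∀ s ∈ Icc 0 t, ⟪Y s, selfSimilarTransport γ 0 V (Y s)⟫ ≤ -(c₁ * ‖Y s‖ ^ 2) := by
          intro s hs
          rw [hWU _ (by linarith [hin s hs])]
          exact hfastR (Y s) (hyR₀.trans (hg s hs).1) (hH s hs) (hvort s hs)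
        have hlow : ∀ s ∈ Icc 0 t, ‖y‖ * Real.exp (c₁ * s) ≤ ‖Y s‖ := by
          intro s hs
          have h1 := norm_ge_mul_exp_of_fastInflow (γ := γ) (V := V) (Y := Y) ht0 (fun σ _ => hY y σ) hch s hs
          simpa [hY0] using h1
        exact fun s hs => ⟨hlow s hs, hup s hs, hH s hs, hch s hs, hvort s hs, hin s hs⟩
      have hgoodT : ∀ s ∈ Icc 0 T, ‖y‖ ≤ ‖Y s‖ ∧ ‖Y s‖ ≤ ‖y‖ * Real.exp (C₁ * s) := by
        by_contra hbad
        push Not at hbad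
        set B : Set ℝ := {s | s ∈ Icc 0 T ∧ (‖y‖ ≤ ‖Y s‖ → ‖y‖ * Real.exp (C₁ * s) < ‖Y s‖)} with hB
        have hBne : B.Nonempty := by obtain ⟨s, hs, hlt⟩ := hbad; exact ⟨s, hs, hlt⟩
        have hBbdd : BddBelow B := ⟨0, fun s hs => hs.1.1⟩
        set t₀ : ℝ := sInf B with ht₀
        have ht₀mem : ∀ s ∈ B, t₀ ≤ s := fun s hs => csInf_le hBbdd hs
        have ht₀0 : 0 ≤ t₀ := le_csInf hBne fun s hs => hs.1.1
        have ht₀T : t₀ ≤ T := by obtain ⟨s, hs⟩ := hBne; exact (ht₀mem s hs).trans hs.1.2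
        have hbefore : ∀ s ∈ Icc 0 T, s < t₀ → ‖y‖ ≤ ‖Y s‖ ∧ ‖Y s‖ ≤ ‖y‖ * Real.exp (C₁ * s) := by
          intro s hs hst
          by_contra hlt
          have hsB : s ∈ B := ⟨hs, fun h1 => by
            by_contra h2
            exact hlt ⟨h1, not_lt.1 h2⟩⟩
          exact absurd (ht₀mem s hsB) (not_le.2 hst)
        have hgood₀ : ∀ s ∈ Icc 0 t₀, ‖y‖ ≤ ‖Y s‖ ∧ ‖Y s‖ ≤ ‖y‖ * Real.exp (C₁ * s) := by
          intro s hs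
          rcases eq_or_lt_of_le hs.2 with heq | hlt
          · -- at `t₀` itself: limit from the left (or `t₀ = 0`)
            rw [heq]
            rcases eq_or_lt_of_le ht₀0 with h00 | h0pos
            · rw [← h00, hY0]; simp
            · have hev : ∀ᶠ σ in 𝓝[<] t₀, σ ∈ Ioo 0 t₀ := Ioo_mem_nhdsLT h0pos
              have hev' : ∀ᶠ σ in 𝓝[<] t₀, ‖y‖ ≤ ‖Y σ‖ ∧ ‖Y σ‖ ≤ ‖y‖ * Real.exp (C₁ * σ) := by
                filter_upwards [hev] with σ hσ
                exact hbefore σ ⟨hσ.1.le, hσ.2.le.trans ht₀T⟩ hσ.2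
              have hc1 : Tendsto (fun σ => ‖Y σ‖) (𝓝[<] t₀) (𝓝 ‖Y t₀‖) := (hYc.norm.tendsto t₀).mono_left nhdsWithin_le_nhds
              have hc2 : Tendsto (fun σ => ‖y‖ * Real.exp (C₁ * σ)) (𝓝[<] t₀) (𝓝 (‖y‖ * Real.exp (C₁ * t₀))) :=
                ((continuous_const.mul (Real.continuous_exp.comp (continuous_const.mul continuous_id))).tendsto t₀).mono_left
                  nhdsWithin_le_nhds
              exact ⟨ge_of_tendsto hc1 (hev'.mono fun σ hσ => hσ.1),
                le_of_tendsto_of_tendsto hc1 hc2 (hev'.mono fun σ hσ => hσ.2)⟩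
          · exact hbefore s ⟨hs.1, hlt.le.trans ht₀T⟩ hlt
        obtain ⟨hlow₀, hup₀, hH₀, hch₀, hvort₀, hin₀⟩ := hgood t₀ ht₀0 ht₀T hgood₀ t₀ ⟨ht₀0, le_rfl⟩
        have hYt₀y : ‖y‖ ≤ ‖Y t₀‖ := (hgood₀ t₀ ⟨ht₀0, le_rfl⟩).1
        have hYt₀1 : 1 ≤ ‖Y t₀‖ := hy1.trans hYt₀y
        have hYt₀pos : 0 < ‖Y t₀‖ := by linarith
        have hcont : Continuous fun σ => ⟪Y σ, selfSimilarTransport γ 0 V (Y σ)⟫ + c₁ / 2 * ‖Y σ‖ ^ 2 := by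
          have hWc : Continuous (selfSimilarTransport γ 0 V) :=
            (PowerGaugeEulerLiouville.Kelvin.contDiff_selfSimilarTransport (γ := γ) hV1).continuous
          exact (hYc.inner (hWc.comp hYc)).add (continuous_const.mul (hYc.norm.pow 2))
        have hneg : ⟪Y t₀, selfSimilarTransport γ 0 V (Y t₀)⟫ + c₁ / 2 * ‖Y t₀‖ ^ 2 < 0 := by
          have : 0 < c₁ / 2 * ‖Y t₀‖ ^ 2 := by positivity
          linarith
        obtain ⟨δ, hδ, hδball⟩ := Metric.continuousAt_iff.1 hcont.continuousAt
          (-(⟪Y t₀, selfSimilarTransport γ 0 V (Y t₀)⟫ + c₁ / 2 * ‖Y t₀‖ ^ 2)) (by linarith)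
        have hch' : ∀ σ ∈ Icc t₀ (t₀ + δ / 2), ⟪Y σ, selfSimilarTransport γ 0 V (Y σ)⟫ ≤ -(c₁ / 2 * ‖Y σ‖ ^ 2) := by
          intro σ hσ
          have hd : dist σ t₀ < δ := by rw [Real.dist_eq, abs_of_nonneg (by linarith [hσ.1])]; linarith [hσ.2]
          have h1 := hδball hd
          rw [Real.dist_eq, abs_lt] at h1
          linarith [h1.2]
        have hesc : ∀ σ ∈ Icc t₀ (t₀ + δ / 2), ‖Y t₀‖ ≤ ‖Y σ‖ := by
          intro σ hσ
          have h1 := norm_ge_mul_exp_of_fastInflow (γ := γ) (V := V) (Y := Y) (c₁ := c₁ / 2) (by linarith : t₀ ≤ t₀ + δ / 2)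
            (fun σ' _ => hY y σ') hch' σ hσ
          have h2 : 1 ≤ Real.exp (c₁ / 2 * (σ - t₀)) := Real.one_le_exp (by nlinarith [hσ.1])
          nlinarith [norm_nonneg (Y t₀)]
        have hO : IsOpen ({σ : ℝ | max R₁ 1 < ‖Y σ‖} ∩ ({σ : ℝ | h < Hb (Y σ)} ∩ {σ : ℝ | curl U (Y σ) ≠ 0})) :=
          (isOpen_lt continuous_const hYc.norm).inter
            ((isOpen_lt continuous_const (hHc.comp hYc)).inter (isOpen_ne_fun (hcurlc.comp hYc) continuous_const))
        have ht₀O : t₀ ∈ {σ : ℝ | max R₁ 1 < ‖Y σ‖} ∩ ({σ : ℝ | h < Hb (Y σ)} ∩ {σ : ℝ | curl U (Y σ) ≠ 0}) := by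
          refine ⟨?_, hH₀, hvort₀⟩
          have : max R₁ 1 ≤ R - 1 := max_le hRR₁ hR1
          show max R₁ 1 < ‖Y t₀‖
          linarith [hAR y hy]
        obtain ⟨δ₂, hδ₂, hδ₂ball⟩ := Metric.isOpen_iff.1 hO t₀ ht₀O
        have hslow' : ∀ σ ∈ Icc t₀ (t₀ + δ₂ / 2), -(C₁ * ‖Y σ‖ ^ 2) ≤ ⟪Y σ, selfSimilarTransport γ 0 V (Y σ)⟫ := by
          intro σ hσ
          have hd : dist σ t₀ < δ₂ := by rw [Real.dist_eq, abs_of_nonneg (by linarith [hσ.1])]; linarith [hσ.2]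
          obtain ⟨h1, h2, h3⟩ := hδ₂ball hd
          exact hslow (Y σ) ((le_max_right _ _).trans h1.le) ((le_max_left _ _).trans h1.le) h2 h3
        have hupc : ∀ σ ∈ Icc t₀ (t₀ + δ₂ / 2), ‖Y σ‖ ≤ ‖y‖ * Real.exp (C₁ * σ) := by
          intro σ hσ
          have h1 := norm_le_mul_exp_of_inflow_ge (γ := γ) (V := V) (Y := Y) (C₁ := C₁) (by linarith : t₀ ≤ t₀ + δ₂ / 2)
            (fun σ' _ => hY y σ') hslow' σ hσ
          have h2 : ‖Y t₀‖ * Real.exp (C₁ * (σ - t₀)) ≤ ‖y‖ * Real.exp (C₁ * t₀) * Real.exp (C₁ * (σ - t₀)) := mul_le_mul_of_nonneg_right hup₀ (Real.exp_pos _).le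
          have h3 : ‖y‖ * Real.exp (C₁ * t₀) * Real.exp (C₁ * (σ - t₀)) = ‖y‖ * Real.exp (C₁ * σ) := by rw [mul_assoc, ← Real.exp_add]; ring_nf
          linarith
        set δs : ℝ := min (δ / 2) (δ₂ / 2) with hδs
        have hδs0 : 0 < δs := lt_min (by linarith) (by linarith)
        have hlb : ∀ s ∈ B, t₀ + δs ≤ s := by
          intro s hs
          by_contra hlt
          push Not at hlt
          have hst₀ : t₀ ≤ s := ht₀mem s hs
          have h1 : ‖y‖ ≤ ‖Y s‖ := hYt₀y.trans (hesc s ⟨hst₀, by linarith [min_le_left (δ / 2) (δ₂ / 2)]⟩)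
          have h2 : ‖Y s‖ ≤ ‖y‖ * Real.exp (C₁ * s) := hupc s ⟨hst₀, by linarith [min_le_right (δ / 2) (δ₂ / 2)]⟩
          exact absurd (hs.2 h1) (not_lt.2 h2)
        have : t₀ + δs ≤ t₀ := le_csInf hBne hlb
        linarith
      intro t ht
      obtain ⟨h1, h2, h3, -, -, -⟩ := hgood T hT le_rfl hgoodT t ht
      exact ⟨h1, h2, h3⟩
    set B' : Set (EuclideanSpace ℝ (Fin 3)) := Φ T ⁻¹' A with hB'
    have hΦTc : Continuous (Φ T) := (C2.Kelvin.contDiff_flow (γ := γ) hV2 hK T).continuous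
    have hB'm : MeasurableSet B' := hΦTc.measurable hAm
    have hΦinv : ∀ y, Φ T (Φ (-T) y) = y := by
      intro y
      have h1 := hflow_add T (-T) y
      rw [add_neg_cancel] at h1
      rw [← h1]; exact ODE.evolutionMap_self _ 0 y
    have hΦinv' : ∀ z, Φ (-T) (Φ T z) = z := by
      intro z
      have h1 := hflow_add (-T) T z
      rw [neg_add_cancel] at h1
      rw [← h1]; exact ODE.evolutionMap_self _ 0 z
    have hB'eq : ∀ z, z ∈ B' ↔ ∃ y ∈ A, z = Φ (-T) y := by
      intro z
      constructor
      · intro hz; exact ⟨Φ T z, hz, (hΦinv' z).symm⟩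
      · rintro ⟨y, hy, rfl⟩
        show Φ T (Φ (-T) y) ∈ A
        rw [hΦinv y]; exact hy
    have himage : Φ T '' B' = A := by
      ext y
      constructor
      · rintro ⟨z, hz, rfl⟩; exact hz
      · intro hy; exact ⟨Φ (-T) y, by show Φ T (Φ (-T) y) ∈ A; rw [hΦinv y]; exact hy, hΦinv y⟩
    have hstay : ∀ z ∈ B', ∀ σ ∈ Icc 0 T, ‖Φ σ z‖ ≤ Rbig - 1 := by
      intro z hz σ hσ
      obtain ⟨y, hy, rfl⟩ := (hB'eq z).1 hz
      have h1 : Φ σ (Φ (-T) y) = Φ (-(T - σ)) y := by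
        rw [← hflow_add σ (-T) y]; congr 1; ring
      rw [h1]
      obtain ⟨-, hup, -⟩ := horbit y hy (T - σ) ⟨by linarith [hσ.2], by linarith [hσ.1]⟩
      have hyR1 : ‖y‖ ≤ R + 1 := by
        rw [hA, mem_ball] at hy
        have h1 : ‖y‖ - ‖y₀‖ ≤ ‖y - y₀‖ := norm_sub_norm_le y y₀
        rw [← dist_eq_norm] at h1
        linarith
      have h2 : Real.exp (C₁ * (T - σ)) ≤ Real.exp (C₁ * T) := Real.exp_le_exp.2 (mul_le_mul_of_nonneg_left (by linarith [hσ.1]) (by rw [hC₁]; positivity))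
      have h3 : ‖y‖ * Real.exp (C₁ * (T - σ)) ≤ (R + 1) * Real.exp (C₁ * T) := mul_le_mul hyR1 h2 (Real.exp_pos _).le (by linarith)
      rw [hRbig]; linarith
    have hdiv : ∀ z : EuclideanSpace ℝ (Fin 3), ‖z‖ ≤ Rbig - 1 → VectorCalculus.divergence V z = 0 := by
      intro z hz
      have hzball : z ∈ ball (0 : EuclideanSpace ℝ (Fin 3)) Rbig := mem_ball_zero_iff.2 (by linarith)
      have hev : V =ᶠ[𝓝 z] U := by
        filter_upwards [isOpen_ball.mem_nhds hzball] with w hw using hVU w hw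
      unfold VectorCalculus.divergence
      rw [hev.fderiv_eq]
      exact hprof.divFree z
    have hvol : volume A = ENNReal.ofReal (Real.exp (3 * γ * T)) * volume B' := by
      rw [← himage]
      exact volume_image_flow_eq_exp_of_stay (γ := γ) hV2 hK hT hdiv hB'm hstay
    have hB'sub : B' ⊆ {z | h < Hb z} ∩ {z | (R - 1) * Real.exp (c₁ * T) ≤ ‖z‖} := by
      intro z hz
      obtain ⟨y, hy, rfl⟩ := (hB'eq z).1 hz
      obtain ⟨hlow, -, hH⟩ := horbit y hy T ⟨hT, le_rfl⟩
      refine ⟨hH, ?_⟩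
      show (R - 1) * Real.exp (c₁ * T) ≤ ‖Φ (-T) y‖
      exact (mul_le_mul_of_nonneg_right (hAR y hy).le (Real.exp_pos _).le).trans hlow
    have hfarR : R₂ ≤ (R - 1) * Real.exp (c₁ * T) := by
      have h1 : 1 ≤ Real.exp (c₁ * T) := Real.one_le_exp (by positivity)
      nlinarith
    have hB'vol : volume B' ≤ ENNReal.ofReal (C' * ((R - 1) * Real.exp (c₁ * T)) ^ (-m)) :=
      (measure_mono hB'sub).trans (hthinR' _ hfarR)
    calc volume A = ENNReal.ofReal (Real.exp (3 * γ * T)) * volume B' := hvol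
      _ ≤ ENNReal.ofReal (Real.exp (3 * γ * T)) * ENNReal.ofReal (C' * ((R - 1) * Real.exp (c₁ * T)) ^ (-m)) :=
          mul_le_mul' le_rfl hB'vol
      _ = ENNReal.ofReal (C' * (R - 1) ^ (-m) * Real.exp ((3 * γ - c₁ * m) * T)) := by
          rw [← ENNReal.ofReal_mul (Real.exp_pos _).le]
          congr 1
          have := rpow_mul_exp_neg_mul_exp (c₁ := c₁) (m := m) (γ := γ) (T := T) hR0
          calc Real.exp (3 * γ * T) * (C' * ((R - 1) * Real.exp (c₁ * T)) ^ (-m))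
              = C' * (Real.exp (3 * γ * T) * ((R - 1) * Real.exp (c₁ * T)) ^ (-m)) := by ring
            _ = C' * ((R - 1) ^ (-m) * Real.exp ((3 * γ - c₁ * m) * T)) := by rw [this]
            _ = C' * (R - 1) ^ (-m) * Real.exp ((3 * γ - c₁ * m) * T) := by ring
  have hδ : 0 < c₁ * m - 3 * γ := by linarith
  have hA0 : volume A = 0 := by
    by_contra hne
    have hvpos : 0 < (volume A).toReal := ENNReal.toReal_pos hne hAtop.ne
    obtain ⟨T, hT0, hT⟩ := exists_mul_exp_neg_lt (K := C' * (R - 1) ^ (-m)) hδ hvpos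
    have h1 := hsqueeze T hT0
    have h2 : C' * (R - 1) ^ (-m) * Real.exp ((3 * γ - c₁ * m) * T) < (volume A).toReal := by
      have : (3 * γ - c₁ * m) * T = -((c₁ * m - 3 * γ) * T) := by ring
      rw [this]; exact hT
    have h3 : volume A < volume A :=
      lt_of_le_of_lt h1 ((ENNReal.ofReal_lt_ofReal_iff hvpos).2 h2 |>.trans_le (ENNReal.ofReal_toReal hAtop.ne).le)
    exact lt_irrefl _ h3
  exact absurd hA0 hApos.ne'

end Summit.NavierStokesRegularity.NavierStokesRegularity.Theorems.PowerGaugeEulerLiouville.Loc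

end
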